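import Summits.Schanuel.Schanuel.Theorems.ZilberEacMovingLine
import Literature.ModelTheory.Zilber.EACDensityNonFree
import HarnessLib

/-!
# The moving-target line family: Mantova–Masser's typed density question DECIDED for `y₀ = A(x₀) + c y₁`

Zilber's Exponential-Algebraic Closedness, case ladder (host summit Schanuel, cell `pub-schanuel`,
seat 2, gen 8).  For the NON-SPLIT surfaces
`W(a, b; A, C c) = {x₁ = a x₀ + b, y₀ = A(x₀) + c y₁} ⊆ ℂ² × ℂ²` (`deg A ≥ 1`, `b, c ∈ ℂ`
arbitrary; exponential points = solutions of `e^{z} = A(z) + c e^{a z + b}`):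

* `mmCase_movingLineSurface_iff`: `W(a, b; A, F)` (any `F`) satisfies the hypotheses of
  Mantova–Masser's case (dim-pi-S-1-free) iff `a ∉ ℚ`; its torus part is multiplicatively free and
  rotund (`isMulFree_movingLineSurface`, seat 1's dominance certificate for `polyFibredGraph`), so
  these are members of the FREE typed question `⟺ Fib(3,2)`.
* `unprojectedDense_movingLine_C`: for EVERY `a ∈ ℂ ∖ ℚ` and all `b, c` the exponential points of
  `W(a, b; A, C c)` are ZARISKI DENSE: `a ∉ ℝ` by THEOREM G, `a ∈ ℝ ∖ ℚ`, `a < 1` by THEOREM I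
  (`ZilberEacMovingLine`), `a > 1` by the INDEX SWAP `(0 ↔ 1)`, which maps `W(a, b; A, C c)` onto
  `W(1/a, -b/a; -A(x/a - b/a)/c, C (1/c))` of slope `1/a < 1` (`indexSwapped_movingLineSurface_C`),
  `c = 0` (the pure moving target `e^{z} = A(z)`) by `unprojectedDense_movingLine_real_zero`.
* `unprojectedDense_movingLine_C_of_mmCase`, `mmCase_and_dense_movingLine_C_iff`: **the typed
  question `MMCaseDimPiOneFree W → UnprojectedDense W` holds on the whole family** — the first
  non-split (non-product) family on which it is decided.
* Examples: `e^{z} = z + e^{√2 z}` (slope `√2 > 1`), `e^{z} = z² - e^{i z}`.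

HONEST FRAMING: explicit families of instances of an OPEN question (MM24 §1 Further remarks); the
general free question (⟺ `ECCellPeriodicStdFib 2`), the slow/fast regimes with non-constant `F` and
`a > 1/(1 + deg F)`, non-line bases, `EC(3,2)` remain OPEN; NOT Schanuel's conjecture; EAC ⇏ SC.
-/

noncomputable section

open Complex MvPolynomial Filter Topology
open Literature.NumberTheory.Transcendental Literature.ModelTheory.Zilber

set_option linter.dupNamespace false

namespace Summit.Schanuel.Schanuel.Theorems

/-! ## Part 1. Cell membership: `W(a, b; A, F)` is in Mantova–Masser's case iff `a ∉ ℚ` -/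

section Membership

variable {a : ℂ} (b : ℂ) {A : Polynomial ℂ} (F : Polynomial ℂ)

/-- `W(a, b; A, F)` meets the torus (`deg A ≥ 1`). [folklore] -/
theorem movingLineSurface_inter_torusLocus_nonempty (a b : ℂ) (hA : 0 < A.natDegree)
    (F : Polynomial ℂ) : (movingLineSurface a b A F ∩ torusLocus ℂ 2).Nonempty :=
  polyFibredGraph_inter_torusLocus_nonempty _ _ _ (aeval_toMvPolynomial_fin_one_injective hA)

/-- `dim cl π(W ∩ G²) = 1` (`deg A ≥ 1`). [folklore] -/
theorem addProjDim_movingLineSurface (a b : ℂ) (hA : 0 < A.natDegree) (F : Polynomial ℂ) :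
    addProjDim ℂ 2 (movingLineSurface a b A F) = (1 : ℕ) :=
  addProjDim_polyFibredGraph _ _ _ (aeval_toMvPolynomial_fin_one_injective hA)

/-- **The torus part of `W(a, b; A, F)` is multiplicatively free** (`deg A ≥ 1`): these surfaces are
members of the FREE density question. [folklore] -/
theorem isMulFree_movingLineSurface (a b : ℂ) (hA : 0 < A.natDegree) (F : Polynomial ℂ) :
    IsMulFree ℂ 2 (movingLineSurface a b A F ∩ torusLocus ℂ 2) :=
  isMulFree_polyFibredGraph _ _ _ (aeval_toMvPolynomial_fin_one_injective hA)

/-- … and rotund. [folklore] -/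
theorem isRotund_movingLineSurface (a b : ℂ) (hA : 0 < A.natDegree) (F : Polynomial ℂ) :
    IsRotund ℂ 2 (movingLineSurface a b A F ∩ torusLocus ℂ 2) :=
  isRotund_polyFibredGraph _ _ _ (aeval_toMvPolynomial_fin_one_injective hA)

/-- **The closure of the base is the whole line** `x₁ = a x₀ + b` (`deg A ≥ 1`). [folklore] -/
theorem zeroLocus_vanishingIdeal_projAdd_movingLineSurface (a b : ℂ) (hA : 0 < A.natDegree)
    (F : Polynomial ℂ) :
    zeroLocus ℂ (vanishingIdeal ℂ (projAdd '' (movingLineSurface a b A F ∩ torusLocus ℂ 2))) =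
      {x : Fin 2 → ℂ | x 1 = a * x 0 + b} := by
  rw [movingLineSurface, vanishingIdeal_projAdd_polyFibredGraph _ _ _
      (aeval_toMvPolynomial_fin_one_injective hA), ← vanishingIdeal_graphBase,
    zeroLocus_vanishingIdeal_of_isZariskiClosed (isZariskiClosed_graphBase _)]
  ext x
  simp only [graphBase, Set.mem_setOf_eq, eval_linBase]
  rfl

/-- For `a ∉ ℚ` the base is not a line of rational slope. [folklore] -/
theorem not_isRationalSlopeLine_movingLineSurface (ha : ∀ r : ℚ, a ≠ (r : ℂ)) (b : ℂ)
    (hA : 0 < A.natDegree) (F : Polynomial ℂ) :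
    ¬ IsRationalSlopeLine (zeroLocus ℂ (vanishingIdeal ℂ
      (projAdd '' (movingLineSurface a b A F ∩ torusLocus ℂ 2)))) := by
  rw [zeroLocus_vanishingIdeal_projAdd_movingLineSurface a b hA F]
  rintro ⟨m, hm, c, hL⟩
  have hsub : ∀ x : ℂ, (m 0 : ℂ) * x + (m 1 : ℂ) * (linePoly a b).eval x = c := by
    intro x
    have hx : (![x, a * x + b] : Fin 2 → ℂ) ∈ {x : Fin 2 → ℂ | x 1 = a * x 0 + b} := by simp
    rw [hL] at hx
    simpa [eval_linePoly] using hx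
  obtain ⟨h0, h1⟩ := lineCoeffs_eq_zero_of_not_rat ha (m 0) (m 1) c hsub
  exact hm (funext fun i => by fin_cases i <;> assumption)

/-- **`W(a, b; A, F)` is in case (dim-pi-S-1-free) for `a ∉ ℚ`** (`deg A ≥ 1`, any `F`). [folklore] -/
theorem mmCase_movingLineSurface (ha : ∀ r : ℚ, a ≠ (r : ℂ)) (b : ℂ) (hA : 0 < A.natDegree)
    (F : Polynomial ℂ) : MMCaseDimPiOneFree (movingLineSurface a b A F) :=
  ⟨isIrreducibleClosed_movingLineSurface _ _ _ _, movingLineSurface_inter_torusLocus_nonempty a b hA F,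
    zariskiDim_movingLineSurface _ _ _ _, addProjDim_movingLineSurface a b hA F,
    not_isRationalSlopeLine_movingLineSurface ha b hA F⟩

/-- … and NOT in the case for rational slope (the base is then a line of rational slope).
[folklore] -/
theorem not_mmCase_movingLineSurface_rat (r : ℚ) (b : ℂ) (hA : 0 < A.natDegree)
    (F : Polynomial ℂ) : ¬ MMCaseDimPiOneFree (movingLineSurface (r : ℂ) b A F) := by
  rintro ⟨-, -, -, -, hline⟩
  apply hline
  rw [zeroLocus_vanishingIdeal_projAdd_movingLineSurface _ b hA F]
  exact isRationalSlopeLine_line_rat r b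

/-- **So on the moving-target line family the case condition is exactly `a ∉ ℚ`.** [folklore] -/
theorem mmCase_movingLineSurface_iff (a b : ℂ) (hA : 0 < A.natDegree) (F : Polynomial ℂ) :
    MMCaseDimPiOneFree (movingLineSurface a b A F) ↔ ∀ r : ℚ, a ≠ (r : ℂ) :=
  ⟨fun h r har => by subst har; exact not_mmCase_movingLineSurface_rat r b hA F h,
    fun ha => mmCase_movingLineSurface ha b hA F⟩

end Membership

/-! ## Part 2. The index swap: slope `a` ↦ slope `1/a` for constant `F = C c` -/

section Swap

/-- **The swapped surface.**  For `a ≠ 0 ≠ c`, swapping the indices `0 ↔ 1` maps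
`W(a, b; A, C c) = {x₁ = a x₀ + b, y₀ = A(x₀) + c y₁}` onto
`W(1/a, -b/a; -A(x/a - b/a)/c, C(1/c))`: `x₀ = a x₁ + b ⟺ x₁ = x₀/a - b/a` and
`y₁ = A(x₁) + c y₀ ⟺ y₀ = -A(x₁)/c + y₁/c`. [folklore] -/
theorem indexSwapped_movingLineSurface_C {a : ℂ} (ha : a ≠ 0) (b : ℂ) (A : Polynomial ℂ) {c : ℂ}
    (hc : c ≠ 0) :
    indexSwapped (movingLineSurface a b A (Polynomial.C c)) =
      movingLineSurface a⁻¹ (-(a⁻¹ * b))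
        (Polynomial.C (-c⁻¹) * A.comp (linePoly a⁻¹ (-(a⁻¹ * b)))) (Polynomial.C c⁻¹) := by
  ext z
  rw [mem_indexSwapped_iff, mem_movingLineSurface_iff, mem_movingLineSurface_iff]
  simp only [Function.comp_apply, idxSwap_inl_zero, idxSwap_inl_one, idxSwap_inr_zero,
    idxSwap_inr_one, Polynomial.eval_C, Polynomial.eval_mul, Polynomial.eval_comp, eval_linePoly]
  constructor
  · rintro ⟨h1, h2⟩
    have h1' : z (Sum.inl 1) = a⁻¹ * z (Sum.inl 0) + -(a⁻¹ * b) := by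
      rw [h1]; field_simp; ring
    refine ⟨h1', ?_⟩
    rw [← h1', h2]
    field_simp
    ring
  · rintro ⟨h1, h2⟩
    have h1' : z (Sum.inl 0) = a * z (Sum.inl 1) + b := by
      rw [h1]; field_simp; ring
    refine ⟨h1', ?_⟩
    rw [h2, ← h1]
    field_simp
    ring

/-- **Real irrational slope `a > 1`, constant `F`: density by the swap.**  For `a ∈ ℝ ∖ ℚ`,
`a > 1`, `deg A ≥ 1`, `c ≠ 0`, the exponential points of `W(a, b; A, C c)` — the solutions of
`e^{z} = A(z) + c e^{a z + b}` — are Zariski dense: the swapped surface has slope `1/a ∈ (0, 1)` and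
additive coefficient `-A(x/a - b/a)/c` of the same degree, so `unprojectedDense_movingLine_real`
applies to it, and density is swap-invariant (`unprojectedDense_indexSwapped_iff`). (new)
[cite: MantovaMasser2023, §1 Further remarks] -/
theorem unprojectedDense_movingLine_real_C_of_one_lt {a : ℝ} (ha : Irrational a) (h1 : 1 < a)
    (b : ℂ) {A : Polynomial ℂ} (hA : 0 < A.natDegree) {c : ℂ} (hc : c ≠ 0) :
    UnprojectedDense (movingLineSurface a b A (Polynomial.C c)) := by
  have ha0' : (a : ℝ) ≠ 0 := (zero_lt_one.trans h1).ne'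
  have ha0 : (a : ℂ) ≠ 0 := by exact_mod_cast ha0'
  rw [← unprojectedDense_indexSwapped_iff, indexSwapped_movingLineSurface_C ha0 b A hc]
  have hinv : ((a : ℂ))⁻¹ = ((a⁻¹ : ℝ) : ℂ) := (Complex.ofReal_inv a).symm
  rw [hinv]
  have hainv0 : ((a⁻¹ : ℝ) : ℂ) ≠ 0 := by rw [← hinv]; exact inv_ne_zero ha0
  have hdeg : (Polynomial.C (-c⁻¹) * A.comp (linePoly ((a⁻¹ : ℝ) : ℂ) (-(((a⁻¹ : ℝ) : ℂ) * b)))).natDegree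
      = A.natDegree := by
    rw [Polynomial.natDegree_C_mul (neg_ne_zero.2 (inv_ne_zero hc)), Polynomial.natDegree_comp,
      linePoly, Polynomial.natDegree_linear hainv0, mul_one]
  refine unprojectedDense_movingLine_real ha.inv _ (by rw [hdeg]; exact hA) _ ?_
  rw [hdeg, Polynomial.natDegree_C, Nat.cast_zero, mul_zero, add_zero]
  have hd : (0 : ℝ) < A.natDegree := by exact_mod_cast hA
  exact mul_lt_of_lt_one_left hd (inv_lt_one_of_one_lt₀ h1)

end Swap

/-! ## Part 3. Every slope `a ∉ ℚ`; the typed question on the family -/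

section AllSlopes

/-- A real number none of whose complexifications is rational is irrational. [folklore] -/
theorem irrational_of_forall_rat_ne {a : ℝ} (ha : ∀ r : ℚ, (a : ℂ) ≠ (r : ℂ)) : Irrational a := by
  rintro ⟨r, hr⟩
  exact ha r (by rw [← hr, Complex.ofReal_ratCast])

/-- **Density on the whole constant-coefficient moving-target family.**  For EVERY `a ∈ ℂ ∖ ℚ`,
all `b, c ∈ ℂ` and `deg A ≥ 1`, the exponential points of
`W(a, b; A, C c) = {x₁ = a x₀ + b, y₀ = A(x₀) + c y₁}` (the solutions of `e^{z} = A(z) + c e^{az+b}`)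
are ZARISKI DENSE in `W`: non-real `a` by THEOREM G, real `a < 1` by THEOREM I, real `a > 1` by
the index swap, `c = 0` by the pure moving target. (new) [cite: MantovaMasser2023, §1 Further remarks] -/
theorem unprojectedDense_movingLine_C {a : ℂ} (ha : ∀ r : ℚ, a ≠ (r : ℂ)) (b c : ℂ)
    {A : Polynomial ℂ} (hA : 0 < A.natDegree) :
    UnprojectedDense (movingLineSurface a b A (Polynomial.C c)) := by
  have hA0 : A ≠ 0 := by rintro rfl; simp at hA
  by_cases him : a.im = 0
  · -- real slope `a = a.re`
    have hare : a = ((a.re : ℝ) : ℂ) := by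
      apply Complex.ext <;> simp [him]
    rw [hare] at ha ⊢
    have hirr : Irrational a.re := irrational_of_forall_rat_ne ha
    by_cases hc : c = 0
    · subst hc
      rw [map_zero]
      exact unprojectedDense_movingLine_real_zero hirr b hA
    have hne1 : a.re ≠ 1 := fun h => hirr ⟨1, by rw [h]; norm_num⟩
    rcases lt_or_gt_of_ne hne1 with hlt | hgt
    · refine unprojectedDense_movingLine_real hirr b hA _ ?_
      rw [Polynomial.natDegree_C, Nat.cast_zero, mul_zero, add_zero]
      exact mul_lt_of_lt_one_left (by exact_mod_cast hA) hlt
    · exact unprojectedDense_movingLine_real_C_of_one_lt hirr hgt b hA hc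
  · exact unprojectedDense_movingLine_of_im_ne_zero him b hA0 _

/-- **Mantova–Masser's typed density question HOLDS on the moving-target family**
`{x₁ = a x₀ + b, y₀ = A(x₀) + c y₁}` (`deg A ≥ 1`; `a, b, c ∈ ℂ` arbitrary): if `W` satisfies the
hypotheses of case (dim-pi-S-1-free), its exponential points are Zariski dense — the first NON-SPLIT
family on which the question is decided. (new) [cite: MantovaMasser2023, §1 Further remarks] -/
theorem unprojectedDense_movingLine_C_of_mmCase {a : ℂ} (b c : ℂ) {A : Polynomial ℂ}
    (hA : 0 < A.natDegree) (h : MMCaseDimPiOneFree (movingLineSurface a b A (Polynomial.C c))) :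
    UnprojectedDense (movingLineSurface a b A (Polynomial.C c)) :=
  unprojectedDense_movingLine_C ((mmCase_movingLineSurface_iff a b hA _).1 h) b c hA

/-- On the family, "in the case" and "in the case with dense exponential points" coincide and both
mean `a ∉ ℚ`. (new) -/
theorem mmCase_and_dense_movingLine_C_iff (a b c : ℂ) {A : Polynomial ℂ} (hA : 0 < A.natDegree) :
    (MMCaseDimPiOneFree (movingLineSurface a b A (Polynomial.C c)) ∧
      UnprojectedDense (movingLineSurface a b A (Polynomial.C c))) ↔ ∀ r : ℚ, a ≠ (r : ℂ) :=
  ⟨fun h => (mmCase_movingLineSurface_iff a b hA _).1 h.1, fun ha =>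
    ⟨mmCase_movingLineSurface ha b hA _, unprojectedDense_movingLine_C ha b c hA⟩⟩

/-- **Positive instances of the FREE typed question** (`⟺ ECCellPeriodicStdFib 2`, seat 2 gen 6):
case ∧ multiplicatively free ∧ dense, for every `a ∉ ℚ`, `b, c ∈ ℂ`, `deg A ≥ 1`. (new) -/
theorem unprojectedDensityQuestion_instance_movingLine_C {a : ℂ} (ha : ∀ r : ℚ, a ≠ (r : ℂ))
    (b c : ℂ) {A : Polynomial ℂ} (hA : 0 < A.natDegree) :
    MMCaseDimPiOneFree (movingLineSurface a b A (Polynomial.C c)) ∧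
      IsMulFree ℂ 2 (movingLineSurface a b A (Polynomial.C c) ∩ torusLocus ℂ 2) ∧
      UnprojectedDense (movingLineSurface a b A (Polynomial.C c)) :=
  ⟨mmCase_movingLineSurface ha b hA _, isMulFree_movingLineSurface a b hA _,
    unprojectedDense_movingLine_C ha b c hA⟩

/-- The same for non-constant fibre polynomials over NON-REAL slopes: case ∧ free ∧ dense for
`W(a, b; A, F)`, `a ∉ ℝ`, `deg A ≥ 1`, any `F`. (new) -/
theorem unprojectedDensityQuestion_instance_movingLine_of_im_ne_zero {a : ℂ} (him : a.im ≠ 0)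
    (b : ℂ) {A : Polynomial ℂ} (hA : 0 < A.natDegree) (F : Polynomial ℂ) :
    MMCaseDimPiOneFree (movingLineSurface a b A F) ∧
      IsMulFree ℂ 2 (movingLineSurface a b A F ∩ torusLocus ℂ 2) ∧
      UnprojectedDense (movingLineSurface a b A F) := by
  have hA0 : A ≠ 0 := by rintro rfl; simp at hA
  have ha : ∀ r : ℚ, a ≠ (r : ℂ) := fun r h => him (by rw [h]; simp)
  exact ⟨mmCase_movingLineSurface ha b hA _, isMulFree_movingLineSurface a b hA _,
    unprojectedDense_movingLine_of_im_ne_zero him b hA0 F⟩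

/-- … and over REAL irrational slopes in the slow-growth regime: case ∧ free ∧ dense for
`W(a, b; A, F)`, `a ∈ ℝ ∖ ℚ`, `a deg A + max(a deg A, 0) deg F < deg A`. (new) -/
theorem unprojectedDensityQuestion_instance_movingLine_real {a : ℝ} (ha : Irrational a) (b : ℂ)
    {A : Polynomial ℂ} (hA : 0 < A.natDegree) (F : Polynomial ℂ)
    (hslow : a * A.natDegree + max (a * A.natDegree) 0 * F.natDegree < A.natDegree) :
    MMCaseDimPiOneFree (movingLineSurface a b A F) ∧
      IsMulFree ℂ 2 (movingLineSurface a b A F ∩ torusLocus ℂ 2) ∧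
      UnprojectedDense (movingLineSurface a b A F) := by
  have ha' : ∀ r : ℚ, (a : ℂ) ≠ (r : ℂ) := by
    intro r h
    exact ha ⟨r, by exact_mod_cast h.symm⟩
  exact ⟨mmCase_movingLineSurface ha' b hA _, isMulFree_movingLineSurface _ b hA _,
    unprojectedDense_movingLine_real ha b hA F hslow⟩

end AllSlopes

/-! ## Part 4. Examples -/

section Examples

/-- `√2 ∉ ℚ`, complex form. [folklore] -/
theorem sqrt_two_ne_ratCast : ∀ r : ℚ, ((Real.sqrt 2 : ℝ) : ℂ) ≠ (r : ℂ) := by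
  intro r h
  exact irrational_sqrt_two ⟨r, by exact_mod_cast h.symm⟩

/-- **`e^{z} = z + e^{√2 z}`**: the exponential points of `{x₁ = √2 x₀, y₀ = x₀ + y₁}` (slope
`√2 > 1`, outside the slow-growth regime; reached by the index swap) are Zariski dense. (new) -/
theorem unprojectedDense_exp_eq_self_add_exp_sqrt_two :
    UnprojectedDense (movingLineSurface (Real.sqrt 2 : ℝ) 0 Polynomial.X (Polynomial.C 1)) :=
  unprojectedDense_movingLine_C sqrt_two_ne_ratCast 0 1 (by rw [Polynomial.natDegree_X]; exact one_pos)

/-- In particular `e^{z} = z + e^{√2 z}` has a solution (density forces existence). (new) -/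
theorem exists_exp_eq_self_add_exp_sqrt_two : ∃ z : ℂ, exp z = z + exp ((Real.sqrt 2 : ℝ) * z) := by
  obtain ⟨p, hpW, hpΓ⟩ := inter_expGraph_nonempty_of_vanishingIdeal_eq
    (movingLineSurface_inter_torusLocus_nonempty ((Real.sqrt 2 : ℝ) : ℂ) 0
      (by rw [Polynomial.natDegree_X]; exact one_pos) (Polynomial.C 1)).left
    unprojectedDense_exp_eq_self_add_exp_sqrt_two
  refine ⟨p (Sum.inl 0), ?_⟩
  rw [mem_movingLineSurface_iff] at hpW
  rw [mem_expGraph_iff] at hpΓ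
  have h0 := hpΓ 0
  have h1 := hpΓ 1
  rw [Literature.ModelTheory.ExponentialFields.ExponentialRing.complex_exp_eq] at h0 h1
  rw [← h0, hpW.2, h1, hpW.1, Polynomial.eval_X, Polynomial.eval_C, mul_one, add_zero]

/-- **`e^{z} = z² - e^{i z}`**: the exponential points of `{x₁ = i x₀, y₀ = x₀² - y₁}` (non-real
slope) are Zariski dense. (new) -/
theorem unprojectedDense_exp_eq_sq_sub_exp_I :
    UnprojectedDense (movingLineSurface I 0 (Polynomial.X ^ 2) (Polynomial.C (-1))) :=
  unprojectedDense_movingLine_C (fun r h => by simpa using congrArg Complex.im h) 0 (-1)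
    (by rw [Polynomial.natDegree_X_pow]; exact two_pos)

end Examples

end Summit.Schanuel.Schanuel.Theorems

end
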